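import Summits.Ventures.HSemireg.WedgeHankelRecurrenceNewtonInversion
import Summits.Ventures.HSemireg.WedgeHankelRecurrenceTraceForm
import Summits.Ventures.HSemireg.WedgeHankelRecurrenceCompanion
import Literature.LinearAlgebra.Matrix.TracePowersDetermineCharpoly

/-!
# Venture HSemireg — THE TRACES OF THE POWERS OF A SQUARE MATRIX ARE THE NEWTON SUMS OF ITS CHARACTERISTIC POLYNOMIAL: **`trace (A^j) = dualSeq χ_A χ_A′ j`** for EVERY square matrix over EVERY
# field (the symbol `χ′/χ` evaluated by the lineage's `dualSeq`; via the algebraic closure, the PROVED Literature `Σ λᵢ^j = Tr(A^j)` and N107), hence NEWTON INVERSION FOR MATRICES (N111 transported):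
# for `d × d` matrices over `K` THE FOLLOWING ARE EQUIVALENT — (i) `1, …, d` are non-zero in `K`; (ii) `Tr(A), …, Tr(A^d)` DETERMINE the characteristic polynomial; (iii) EVERY vector
# `(τ_1, …, τ_d) ∈ K^d` is `(Tr(A), …, Tr(A^d))` for some `A` — extending the tree's characteristic-`0` uniqueness theorem (Cox–Little–O'Shea ∕ Rossmann, PROVED Literature) to the sharp hypothesis,
# adding existence (companion matrices of Newton-inverted polynomials) and both converse witnesses.

HONEST FRAMING. Part of the Lean index of the computation cell `pub-hsemireg` (seat p10 gen 32, Sunday typer «UNIFORM-IN-n»).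
LINEAR ALGEBRA OF HANKEL (catalecticant) MATRICES and of polynomials over a field ONLY (`Matrix.charpoly`, `Matrix.trace`, the lineage's `dualSeq` ∕ `mulResidueMat`): no variety, no cohomology theory,
no sheaf, no Ext group and no semiregularity map is constructed here; nothing here says that HC / HC_CM / HC_AV holds; no Literature FACT is declared or used — one PROVED Literature theorem is imported
(`Literature.LinearAlgebra.Matrix.sum_roots_charpoly_map_pow`, Rossmann §1.2 Lemma 6: over an algebraically closed field `Σ_{roots of χ_A} λ^m = Tr(A^m)`).  Custodian versions as in `WedgeHankelSiegelIdeal` (1/3).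

WHAT IS IN THE TREE.  N111 (`WedgeHankelRecurrenceNewtonInversion`): `eq_of_dualSeq_derivative_eq`, `exists_monic_dualSeq_derivative_eq`, `dualSeq_derivative_X_pow_mul_eq_of_cast_eq_zero`,
`dualSeq_derivative_ne_single_of_cast_eq_zero`, `exists_ringChar_le_of_cast_eq_zero`.  N103 (`WedgeHankelRecurrenceTraceForm`): `trace_mulResidueMat_X_pow` (`trace (M_X^j) = dualSeq m m′ j` for the
multiplication-by-`X` matrix of `K[X]/(m)`).  N82 (`WedgeHankelRecurrenceCompanion`): `charpoly_mulResidueMat_X` (`χ(M_X) = m`).  N107 (`WedgeHankelRecurrenceSplitting`): `map_dualSeq_derivative_eq_sum_roots_pow`.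
PROVED Literature `LinearAlgebra/Matrix/TracePowersDetermineCharpoly`: `sum_roots_charpoly_map_pow` (imported, used), `Matrix.charpoly_eq_charpoly_of_trace_pow_eq` (CHARACTERISTIC `0`: equal traces of powers
`1 ≤ m ≤ n` ⇒ equal characteristic polynomials — the `[CharZero]` case of §682's uniqueness; cited, not restated).  Mathlib: `Matrix.charpoly_map`, `Matrix.charpoly_monic`, `Matrix.charpoly_natDegree_eq_dim`,
`AddMonoidHom.map_trace`, `Matrix.map_pow`; Mathlib has `trace = −(next coefficient)` and `det` but no `Tr(A^j)`-Newton statement.  PROVED Literature `RepresentationTheory/FiniteGroups/TracePowCharpoly`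
(`trace_pow_eq_of_charpoly_eq` for `f^N = 1`, `K` algebraically closed) is the finite-order special case of §681's corollary; not imported.
THIS FILE (namespace `Summit.Ventures.HSemireg.Wedge.HankelOuter` continued; CHAINED on N111; 0 definitions):
* §681 **`trace_pow_eq_dualSeq_charpoly_derivative`** (`Tr(A^j) = dualSeq χ_A χ_A′ j`, every field, every `j`), `trace_pow_eq_trace_pow_of_charpoly_eq` (equal `χ` ⇒ equal traces of all powers; the
  PROVED Literature `RepresentationTheory/FiniteGroups/TracePowCharpoly` has this for FINITE-ORDER endomorphisms over algebraically closed fields via semisimplicity — here unconditional).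
* §682 **`charpoly_eq_charpoly_of_trace_pow_eq_of_cast_ne_zero`** ((i) ⇒ (ii), matrices of the same size `d` indexed by any finite types), **`exists_matrix_trace_pow_eq`** ((i) ⇒ (iii), companion matrix
  of the Newton-inverted polynomial), `existsUnique_charpoly_of_trace_pow` (the realised characteristic polynomial is unique).
* §683 converses: **`exists_matrix_trace_pow_eq_charpoly_ne`** (`(p : K) = 0`, `1 ≤ p ≤ d` ⇒ the companions of `X^d` and `X^{d−p}(X − 1)^p` have equal traces of ALL positive powers and different
  `χ`), **`trace_pow_ne_single_of_cast_eq_zero`** (`(k : K) = 0`, `1 ≤ k ≤ d` ⇒ no `d × d` matrix has `Tr(A^j) = 0` (`1 ≤ j < k`), `Tr(A^k) = 1`), **`forall_cast_ne_zero_iff_trace_pow_determine_charpoly`**,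
  **`forall_cast_ne_zero_iff_trace_pow_surjective`** (THE EQUIVALENCES for `Matrix (Fin d) (Fin d) K`).
Nothing Ext-side.  New names only.
-/

open Module Polynomial
open scoped Matrix Polynomial

namespace Summit.Ventures.HSemireg.Wedge.HankelOuter

open Summit.Ventures.HSemireg.Wedge Summit.Ventures.HSemireg.Wedge.Hankel

variable (K : Type*) [Field K]

/-! ## §681. `Tr(A^j)` is the `j`-th Newton sum of `χ_A` -/

/-- **`trace (A^j) = dualSeq χ_A χ_A′ j` for every square matrix `A` over every field and every `j`** — the traces of the powers are the Newton sums of the characteristic polynomial, read as the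
lineage's symbol `χ′/χ` (over the algebraic closure: `Tr(A^j) = Σ λᵢ^j` (PROVED Literature, Rossmann §1.2 Lemma 6) `= dualSeq χ χ′ j` (N107); both sides are `K`-rational). -/
theorem trace_pow_eq_dualSeq_charpoly_derivative {ι : Type*} [Fintype ι] [DecidableEq ι] (A : Matrix ι ι K) (j : ℕ) :
    (A ^ j).trace = dualSeq K A.charpoly (derivative A.charpoly) j := by
  apply (algebraMap K (AlgebraicClosure K)).injective
  rw [map_dualSeq_derivative_eq_sum_roots_pow K (algebraMap K (AlgebraicClosure K)) A.charpoly_monic (IsAlgClosed.splits _) j, ← Matrix.charpoly_map,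
    Literature.LinearAlgebra.Matrix.sum_roots_charpoly_map_pow, ← Matrix.map_pow, AddMonoidHom.map_trace]

/-- Matrices with the same characteristic polynomial have the same traces of all powers (any sizes ∕ index types, any field). -/
theorem trace_pow_eq_trace_pow_of_charpoly_eq {ι κ : Type*} [Fintype ι] [DecidableEq ι] [Fintype κ] [DecidableEq κ] {A : Matrix ι ι K} {B : Matrix κ κ K} (h : A.charpoly = B.charpoly) (j : ℕ) :
    (A ^ j).trace = (B ^ j).trace := by
  rw [trace_pow_eq_dualSeq_charpoly_derivative K A, trace_pow_eq_dualSeq_charpoly_derivative K B, h]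

/-! ## §682. Newton inversion for matrices when `1, …, d` are non-zero in `K` -/

/-- **`Tr(A), …, Tr(A^d)` DETERMINE `χ_A` when `1, …, d` are non-zero in `K`** (`A`, `B` square of the same size `d`, indexed by any finite types; the `[CharZero]` case is the PROVED Literature
`Matrix.charpoly_eq_charpoly_of_trace_pow_eq`; here characteristic `p > d` is allowed, and §683 shows nothing weaker than (i) suffices). -/
theorem charpoly_eq_charpoly_of_trace_pow_eq_of_cast_ne_zero {ι κ : Type*} [Fintype ι] [DecidableEq ι] [Fintype κ] [DecidableEq κ] (A : Matrix ι ι K) (B : Matrix κ κ K)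
    (hcard : Fintype.card ι = Fintype.card κ) (hchar : ∀ k : ℕ, 1 ≤ k → k ≤ Fintype.card ι → (k : K) ≠ 0)
    (h : ∀ j, 1 ≤ j → j ≤ Fintype.card ι → (A ^ j).trace = (B ^ j).trace) : A.charpoly = B.charpoly :=
  eq_of_dualSeq_derivative_eq K A.charpoly_monic B.charpoly_monic (by rw [Matrix.charpoly_natDegree_eq_dim, Matrix.charpoly_natDegree_eq_dim, hcard])
    (fun k hk hkd => hchar k hk (by rwa [Matrix.charpoly_natDegree_eq_dim] at hkd)) fun j hj hjd => by
      rw [← trace_pow_eq_dualSeq_charpoly_derivative, ← trace_pow_eq_dualSeq_charpoly_derivative, h j hj (by rwa [Matrix.charpoly_natDegree_eq_dim] at hjd)]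

/-- **EVERY TRACE VECTOR IS REALISED when `1, …, d` are non-zero in `K`: for every `(τ_1, …, τ_d)` there is a `d × d` matrix `A` with `Tr(A^j) = τ_j`, `1 ≤ j ≤ d`** — the multiplication-by-`X`
(companion) matrix of the monic polynomial with Newton sums `τ` (N111's existence + N103). -/
theorem exists_matrix_trace_pow_eq (d : ℕ) (hchar : ∀ k : ℕ, 1 ≤ k → k ≤ d → (k : K) ≠ 0) (τ : ℕ → K) :
    ∃ A : Matrix (Fin d) (Fin d) K, ∀ j, 1 ≤ j → j ≤ d → (A ^ j).trace = τ j := by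
  rcases d with _ | t
  · exact ⟨0, fun j hj hj0 => by omega⟩
  · obtain ⟨m, hm, hmd, hmq⟩ := exists_monic_dualSeq_derivative_eq K (t + 1) hchar τ
    exact ⟨mulResidueMat K t m Polynomial.X, fun j hj hjd => by rw [trace_mulResidueMat_X_pow K hm hmd, hmq j hj hjd]⟩

/-- The realised characteristic polynomial is unique: if `1, …, d` are non-zero in `K`, for every trace vector `τ` there is EXACTLY ONE monic `χ` of degree `d` such that every `d × d` matrix `A` with
`Tr(A^j) = τ_j` (`1 ≤ j ≤ d`) has `χ_A = χ` — and such matrices exist. -/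
theorem existsUnique_charpoly_of_trace_pow (d : ℕ) (hchar : ∀ k : ℕ, 1 ≤ k → k ≤ d → (k : K) ≠ 0) (τ : ℕ → K) :
    ∃! χ : K[X], χ.Monic ∧ χ.natDegree = d ∧ ∀ A : Matrix (Fin d) (Fin d) K, (∀ j, 1 ≤ j → j ≤ d → (A ^ j).trace = τ j) → A.charpoly = χ := by
  obtain ⟨A₀, hA₀⟩ := exists_matrix_trace_pow_eq K d hchar τ
  have hdA : ∀ A : Matrix (Fin d) (Fin d) K, A.charpoly.natDegree = d := fun A => by rw [Matrix.charpoly_natDegree_eq_dim, Fintype.card_fin]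
  refine ⟨A₀.charpoly, ⟨A₀.charpoly_monic, hdA A₀, fun A hA => ?_⟩, fun χ ⟨_, _, hχ⟩ => (hχ A₀ hA₀).symm⟩
  exact charpoly_eq_charpoly_of_trace_pow_eq_of_cast_ne_zero K A A₀ rfl (fun k hk hkd => hchar k hk (by rwa [Fintype.card_fin] at hkd)) fun j hj hjd => by
    rw [Fintype.card_fin] at hjd
    rw [hA j hj hjd, hA₀ j hj hjd]

/-! ## §683. The converses: what fails when some `k ≤ d` vanishes in `K` -/

/-- **Uniqueness FAILS when `p ≤ d` vanishes in `K`: the companion matrices of `X^{d−p}(X − 1)^p` and of `X^d` (both `d × d`) have the same trace of EVERY positive power and different characteristic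
polynomials** (N111's witness transported by N103 and N82). Stated for `d = t + 1`. -/
theorem exists_matrix_trace_pow_eq_charpoly_ne {p t : ℕ} (hp : (p : K) = 0) (hp1 : 1 ≤ p) (hpd : p ≤ t + 1) :
    ∃ A B : Matrix (Fin (t + 1)) (Fin (t + 1)) K, (∀ j, 1 ≤ j → (A ^ j).trace = (B ^ j).trace) ∧ A.charpoly ≠ B.charpoly := by
  have hmon : ((Polynomial.X : K[X]) ^ (t + 1 - p) * (Polynomial.X - C 1) ^ p).Monic := (Polynomial.monic_X_pow _).mul ((Polynomial.monic_X_sub_C 1).pow _)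
  have hdeg : ((Polynomial.X : K[X]) ^ (t + 1 - p) * (Polynomial.X - C 1) ^ p).natDegree = t + 1 := by
    rw [Polynomial.natDegree_mul (Polynomial.monic_X_pow _).ne_zero ((Polynomial.monic_X_sub_C 1).pow _).ne_zero, Polynomial.natDegree_X_pow, Polynomial.natDegree_pow, Polynomial.natDegree_X_sub_C, mul_one]
    omega
  refine ⟨mulResidueMat K t ((Polynomial.X : K[X]) ^ (t + 1 - p) * (Polynomial.X - C 1) ^ p) Polynomial.X, mulResidueMat K t ((Polynomial.X : K[X]) ^ (t + 1)) Polynomial.X, fun j hj => ?_, ?_⟩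
  · rw [trace_mulResidueMat_X_pow K hmon hdeg, trace_mulResidueMat_X_pow K (Polynomial.monic_X_pow _) (Polynomial.natDegree_X_pow _), (dualSeq_derivative_X_pow_mul_eq_of_cast_eq_zero K (t + 1) hp hp1 hj).1]
  · rw [charpoly_mulResidueMat_X K hmon hdeg, charpoly_mulResidueMat_X K (Polynomial.monic_X_pow _) (Polynomial.natDegree_X_pow _)]
    exact (dualSeq_derivative_X_pow_mul_eq_of_cast_eq_zero K (t + 1) hp hp1 hp1).2

/-- **Surjectivity FAILS when `k ≤ d` vanishes in `K`: NO `d × d` matrix has `Tr(A^j) = 0` for `1 ≤ j < k` and `Tr(A^k) = 1`** (any finite index type of cardinality `d`; §681 + N111's solved Newton identity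
for `χ_A`). -/
theorem trace_pow_ne_single_of_cast_eq_zero {ι : Type*} [Fintype ι] [DecidableEq ι] {k : ℕ} (hk : (k : K) = 0) (hk1 : 1 ≤ k) (hkd : k ≤ Fintype.card ι) (A : Matrix ι ι K)
    (h : ∀ j, 1 ≤ j → j < k → (A ^ j).trace = 0) : (A ^ k).trace ≠ 1 := by
  rw [trace_pow_eq_dualSeq_charpoly_derivative]
  exact dualSeq_derivative_ne_single_of_cast_eq_zero K hk hk1 hkd A.charpoly_monic (Matrix.charpoly_natDegree_eq_dim A) fun j hj hjk => by rw [← trace_pow_eq_dualSeq_charpoly_derivative, h j hj hjk]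

/-- **THE EQUIVALENCE (i) ⟺ (ii) for matrices: `1, …, d` are non-zero in `K` iff `d × d` matrices with the same `Tr(A^j)`, `1 ≤ j ≤ d`, have the same characteristic polynomial.** -/
theorem forall_cast_ne_zero_iff_trace_pow_determine_charpoly (d : ℕ) :
    (∀ k : ℕ, 1 ≤ k → k ≤ d → (k : K) ≠ 0) ↔
      ∀ A B : Matrix (Fin d) (Fin d) K, (∀ j, 1 ≤ j → j ≤ d → (A ^ j).trace = (B ^ j).trace) → A.charpoly = B.charpoly := by
  refine ⟨fun hc A B h => charpoly_eq_charpoly_of_trace_pow_eq_of_cast_ne_zero K A B rfl (fun k hk hkd => hc k hk (by rwa [Fintype.card_fin] at hkd))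
    fun j hj hjd => h j hj (by rwa [Fintype.card_fin] at hjd), fun h => ?_⟩
  by_contra hneg
  push Not at hneg
  obtain ⟨k, hk1, hkd, hk⟩ := hneg
  obtain ⟨hp, hp1, hpd⟩ := exists_ringChar_le_of_cast_eq_zero K hk hk1 hkd
  obtain ⟨t, rfl⟩ : ∃ t, d = t + 1 := ⟨d - 1, by omega⟩
  obtain ⟨A, B, hAB, hne⟩ := exists_matrix_trace_pow_eq_charpoly_ne K hp hp1 hpd
  exact hne (h A B fun j hj _ => hAB j hj)

/-- **THE EQUIVALENCE (i) ⟺ (iii) for matrices: `1, …, d` are non-zero in `K` iff every `(τ_1, …, τ_d) ∈ K^d` is the trace vector `(Tr(A), …, Tr(A^d))` of some `d × d` matrix.** -/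
theorem forall_cast_ne_zero_iff_trace_pow_surjective (d : ℕ) :
    (∀ k : ℕ, 1 ≤ k → k ≤ d → (k : K) ≠ 0) ↔ ∀ τ : ℕ → K, ∃ A : Matrix (Fin d) (Fin d) K, ∀ j, 1 ≤ j → j ≤ d → (A ^ j).trace = τ j := by
  refine ⟨fun hc τ => exists_matrix_trace_pow_eq K d hc τ, fun h => ?_⟩
  by_contra hneg
  push Not at hneg
  obtain ⟨k, hk1, hkd, hk⟩ := hneg
  obtain ⟨A, hA⟩ := h fun j => if j = k then 1 else 0
  have h1 : (A ^ k).trace = 1 := by rw [hA k hk1 hkd, if_pos rfl]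
  exact trace_pow_ne_single_of_cast_eq_zero K hk hk1 (by rwa [Fintype.card_fin]) A (fun j hj hjk => by rw [hA j hj (by omega), if_neg (by omega)]) h1

end Summit.Ventures.HSemireg.Wedge.HankelOuter
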